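import Literature.Geometry.Riemannian.GeodesicChartBridge
import Literature.Geometry.Lorentzian.FlatParallelFrame
import HarnessLib

/-!
# The covariant derivative along a curve, read in a chart

For a smooth pseudo-Riemannian metric `g` on a boundaryless manifold `M` modelled on `E`, a curve
`γ` in `M` and a field `W` along `γ` whose lift to `TM` is differentiable at `t₀`, with `γ t₀` in
the domain of the chart at `x₁`: writing `ŵ(t) = D(extChartAt x₁)(W t)` for the components of `W`
and `U = D(extChartAt x₁)(γ')` for the coordinate velocity,

* `covariantDerivAlong_chart` — **`D(extChartAt x₁)(D_t W)(t₀) = ŵ'(t₀) + Γ_{c t₀}(U t₀, ŵ t₀)`**,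
  `Γ = MetricCoord.chrAt (chartRep g x₁ 0)` the Christoffel map of the chart components
  (O'Neill 1983, Ch. 3, Prop. 3.18 (3): `(V')ᵏ = dVᵏ/dt + Γᵏᵢⱼ (dxⁱ/dt) Vʲ`);
* `hasDerivAt_chart_of_isParallelAlongOn` — hence **a parallel field satisfies the linear system
  `ŵ' = −Γ_c(U, ŵ)`** in every chart.

Proof: near `t₀` the pair `(γ, W)` is the image under `Φ = chartInv x₁` and `dΦ` of the curve
`ĉ = extChartAt x₁ ∘ γ` in the open chart target and the field `ŵ` along it; by the naturality of
the induced covariant derivative under the isometry `Φ : (chartTarget, Φ^*g) → (M, g)`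
(`mfderiv_covariantDerivAlong_comap`) `D^g_t W = dΦ (D^{Φ^*g}_t ŵ)`, and on the open subset of
`E` the induced covariant derivative is `ŵ' + ∑ᵢ ŵⁱ ∇_{U} bᵢ = ŵ' + Γ(U, ŵ)`
(`continuousLinearMapAt_covariantDerivAlong_symmL`, `OpensChart.leviCivita_const_apply`,
`OpensChart.christoffel_eq_chrAt`). With `GeodesicChartBridge` (`U' = −Γ(U, U)` along geodesics)
this completes the dictionary between the intrinsic calculus along geodesics of `M` and the
coordinate calculus of `Lorentzian/Coord*` (`CoordParallelFieldCurves`, `CoordNullLeafCalculus`).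
Everything is proved; no definitions are introduced.

## References

* B. O'Neill, *Semi-Riemannian geometry*, Academic Press 1983, Ch. 3, Prop. 3.18 and Prop. 3.59.
  [ONeill1983]
-/

noncomputable section

set_option maxSynthPendingDepth 3

open Bundle Set Function Filter Module Metric
open scoped Manifold ContDiff Topology

namespace Literature.Geometry.Riemannian

open Lorentzian Lorentzian.PseudoRiemannianMetric

universe u

variable {E : Type u} [NormedAddCommGroup E] [NormedSpace ℝ E] [FiniteDimensional ℝ E]
  [CompleteSpace E] {M : Type*} [TopologicalSpace M] [ChartedSpace E M] [IsManifold 𝓘(ℝ, E) ∞ M]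
  (g : PseudoRiemannianMetric 𝓘(ℝ, E) ∞ E (TangentSpace 𝓘(ℝ, E) : M → Type _))

omit [FiniteDimensional ℝ E] [CompleteSpace E] in
/-- The fibre component of the trivialisation of `TM` at `x₁` is the differential of the extended
chart: `(𝓣[x₁] ⟨y, w⟩).2 = D(extChartAt x₁)_y w` on the chart domain
(`TangentBundle.continuousLinearMapAt_trivializationAt`). [folklore] -/
theorem trivializationAt_snd_eq_mfderiv (x₁ : M) {y : M} (hy : y ∈ (extChartAt 𝓘(ℝ, E) x₁).source)
    (w : TangentSpace 𝓘(ℝ, E) y) :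
    (trivializationAt E (TangentSpace 𝓘(ℝ, E)) x₁ ⟨y, w⟩).2 =
      mfderiv 𝓘(ℝ, E) 𝓘(ℝ, E) (extChartAt 𝓘(ℝ, E) x₁) y w := by
  rw [extChartAt_source] at hy
  rw [← Trivialization.continuousLinearMapAt_apply_of_mem ℝ _ (by simpa using hy),
    TangentBundle.continuousLinearMapAt_trivializationAt hy]
  rfl

variable [g.HasLeviCivita]

/-- **The covariant derivative along a curve in a chart** (O'Neill 1983, Ch. 3, Prop. 3.18 (3)).
For a field `W` along `γ` with differentiable lift at `t₀` and `γ t₀` in the domain of the chart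
at `x₁`: the components `ŵ = D(extChartAt x₁)(W)` are differentiable at `t₀`, and
`D(extChartAt x₁)(D_t W)(t₀) = ŵ'(t₀) + Γ_{c t₀}(U t₀, ŵ t₀)` with `Γ = chrAt (chartRep g x₁ 0)`,
`U = D(extChartAt x₁)(γ')`. [cite: ONeill1983, Ch. 3, Prop. 3.18 and Prop. 3.59] -/
theorem covariantDerivAlong_chart (x₁ : M) {γ : ℝ → M}
    {W : Π t : ℝ, TangentSpace 𝓘(ℝ, E) (γ t)} {t₀ : ℝ}
    (hx : γ t₀ ∈ (extChartAt 𝓘(ℝ, E) x₁).source)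
    (hW : MDifferentiableAt 𝓘(ℝ, ℝ) 𝓘(ℝ, E).tangent
      (fun t ↦ (TotalSpace.mk' E (γ t) (W t) : TangentBundle 𝓘(ℝ, E) M)) t₀) :
    DifferentiableAt ℝ
        (fun t ↦ mfderiv 𝓘(ℝ, E) 𝓘(ℝ, E) (extChartAt 𝓘(ℝ, E) x₁) (γ t) (W t)) t₀ ∧
    mfderiv 𝓘(ℝ, E) 𝓘(ℝ, E) (extChartAt 𝓘(ℝ, E) x₁) (γ t₀)
        (covariantDerivAlong g.leviCivita γ W t₀) =
      deriv (fun t ↦ mfderiv 𝓘(ℝ, E) 𝓘(ℝ, E) (extChartAt 𝓘(ℝ, E) x₁) (γ t) (W t)) t₀ +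
        MetricCoord.chrAt (chartRep 𝓘(ℝ, E) (fun _ ↦ g) x₁ 0) (extChartAt 𝓘(ℝ, E) x₁ (γ t₀))
          (mfderiv 𝓘(ℝ, E) 𝓘(ℝ, E) (extChartAt 𝓘(ℝ, E) x₁) (γ t₀) (velocity 𝓘(ℝ, E) γ t₀))
          (mfderiv 𝓘(ℝ, E) 𝓘(ℝ, E) (extChartAt 𝓘(ℝ, E) x₁) (γ t₀) (W t₀)) := by
  haveI := (chartPullback 𝓘(ℝ, E) g x₁).hasLeviCivita
  set φ := extChartAt 𝓘(ℝ, E) x₁ with hφ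
  set G := chartRep 𝓘(ℝ, E) (fun _ ↦ g) x₁ 0 with hGdef
  have hG := val_chartPullback_eq_chartRep (fun _ : ℝ ↦ g) x₁ 0
  have hGm : MetricCoord.IsMetricOn G φ.target := Lorentzian.OpensChart.isMetricOn_repr hG
  have hGd : ∀ y : chartTarget 𝓘(ℝ, E) x₁, DifferentiableAt ℝ G y := fun y ↦
    hGm.differentiableAt y.2
  set Φ := chartInv 𝓘(ℝ, E) x₁ with hΦdef
  -- differentiability of `γ`; `γ` stays in the chart domain near `t₀`
  have hγ : MDifferentiableAt 𝓘(ℝ, ℝ) 𝓘(ℝ, E) γ t₀ := mdifferentiableAt_of_mdifferentiableAt_lift hW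
  have hsrc : ∀ᶠ t in 𝓝 t₀, γ t ∈ φ.source :=
    hγ.continuousAt.preimage_mem_nhds ((isOpen_extChartAt_source x₁).mem_nhds hx)
  have hx' : γ t₀ ∈ (chartAt E x₁).source := by rwa [← extChartAt_source 𝓘(ℝ, E)]
  -- the components `ŵ` are differentiable at `t₀`
  set w : ℝ → E := fun t ↦ mfderiv 𝓘(ℝ, E) 𝓘(ℝ, E) φ (γ t) (W t) with hwdef
  have hwev : (fun t ↦ (trivializationAt E (TangentSpace 𝓘(ℝ, E)) x₁ ⟨γ t, W t⟩).2) =ᶠ[𝓝 t₀] w := by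
    filter_upwards [hsrc] with t ht
    exact trivializationAt_snd_eq_mfderiv x₁ ht (W t)
  have hwd : DifferentiableAt ℝ w t₀ :=
    (differentiableAt_trivialization_lift (trivializationAt E (TangentSpace 𝓘(ℝ, E)) x₁) hW
      (by rw [TangentBundle.trivializationAt_baseSet]; exact hx')).congr_of_eventuallyEq hwev.symm
  refine ⟨hwd, ?_⟩
  -- the coordinate velocity
  set U₀ : E := mfderiv 𝓘(ℝ, E) 𝓘(ℝ, E) φ (γ t₀) (velocity 𝓘(ℝ, E) γ t₀) with hU₀
  have hcd : HasDerivAt (φ ∘ γ) U₀ t₀ := by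
    have h := hasDerivAt_extChartAt_comp (I := 𝓘(ℝ, E)) hγ hx'
    rwa [trivializationAt_snd_eq_mfderiv x₁ hx] at h
  -- the curve in the open chart target and the field along it
  classical
  set ĉ : ℝ → chartTarget 𝓘(ℝ, E) x₁ := fun t ↦
    if h : γ t ∈ φ.source then ⟨φ (γ t), φ.map_source h⟩ else ⟨φ (γ t₀), φ.map_source hx⟩
    with hĉdef
  have hĉeq : ∀ t (ht : γ t ∈ φ.source), ĉ t = ⟨φ (γ t), φ.map_source ht⟩ := fun t ht ↦ by
    simp only [hĉdef, dif_pos ht]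
  have hĉval : ∀ t, γ t ∈ φ.source → (ĉ t : E) = φ (γ t) := fun t ht ↦ by rw [hĉeq t ht]
  have hΦĉ : ∀ t, γ t ∈ φ.source → Φ (ĉ t) = γ t := fun t ht ↦ by
    rw [hĉeq t ht, hΦdef, chartInv_apply]
    exact φ.left_inv ht
  have hdΦ : ∀ t (ht : γ t ∈ φ.source), mfderiv 𝓘(ℝ, E) 𝓘(ℝ, E) Φ (ĉ t) (w t) = W t := by
    intro t ht
    rw [hĉeq t ht]
    exact mfderiv_chartInv_mfderiv_extChartAt x₁ ht (W t)
  -- (i) the lifts agree near `t₀`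
  have hlift : (fun t ↦ (TotalSpace.mk' E ((Φ ∘ ĉ) t)
      (mfderiv 𝓘(ℝ, E) 𝓘(ℝ, E) Φ (ĉ t) (w t)) : TangentBundle 𝓘(ℝ, E) M)) =ᶠ[𝓝 t₀]
      fun t ↦ (TotalSpace.mk' E (γ t) (W t) : TangentBundle 𝓘(ℝ, E) M) := by
    filter_upwards [hsrc] with t ht
    have key : ∀ (y : M), y = γ t → ∀ (a : E), a = (W t : E) →
        (TotalSpace.mk' E y (show TangentSpace 𝓘(ℝ, E) y from a) : TangentBundle 𝓘(ℝ, E) M) =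
          TotalSpace.mk' E (γ t) (W t) := by
      rintro y rfl a rfl; rfl
    exact key _ (hΦĉ t ht) _ (hdΦ t ht)
  have hcongr := covariantDerivAlong_congr_of_eventuallyEq (cov := g.leviCivita) hlift
  -- (ii) differentiability of `ĉ` and of the lift `(ĉ, w)` in `T(chartTarget)`
  have hcval : (fun t ↦ (ĉ t : E)) =ᶠ[𝓝 t₀] (φ ∘ γ) := by
    filter_upwards [hsrc] with t ht
    exact hĉval t ht
  have hcvald : HasDerivAt (fun t ↦ (ĉ t : E)) U₀ t₀ := hcd.congr_of_eventuallyEq hcval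
  have hĉd : MDifferentiableAt 𝓘(ℝ, ℝ) 𝓘(ℝ, E) ĉ t₀ := by
    have htgt : (ĉ t₀ : E) ∈ (extChartAt 𝓘(ℝ, E) (ĉ t₀)).target := by
      rw [OpensChart.extChartAt_target]; exact (ĉ t₀).2
    have h1 : MDifferentiableAt 𝓘(ℝ, E) 𝓘(ℝ, E) (extChartAt 𝓘(ℝ, E) (ĉ t₀)).symm (ĉ t₀ : E) :=
      (mdifferentiableWithinAt_extChartAt_symm htgt).mdifferentiableAt
        (by rw [ModelWithCorners.range_eq_univ]; exact univ_mem)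
    have h2 : MDifferentiableAt 𝓘(ℝ, ℝ) 𝓘(ℝ, E) (fun t ↦ (ĉ t : E)) t₀ :=
      mdifferentiableAt_iff_differentiableAt.2 hcvald.differentiableAt
    have h3 := h1.comp t₀ h2
    have h4 : ((extChartAt 𝓘(ℝ, E) (ĉ t₀)).symm ∘ fun t ↦ (ĉ t : E)) = ĉ := by
      funext t
      simp only [Function.comp_apply]
      rw [← OpensChart.extChartAt_apply (ĉ t₀) (ĉ t)]
      exact (extChartAt 𝓘(ℝ, E) (ĉ t₀)).left_inv
        (by rw [OpensChart.extChartAt_source]; exact mem_univ _)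
    rwa [h4] at h3
  have hvel : velocity 𝓘(ℝ, E) ĉ t₀ = U₀ := by
    have h := hasDerivAt_extChartAt_comp (I := 𝓘(ℝ, E)) (x₁ := ĉ t₀) hĉd
      (by rw [OpensChart.chartAt_source]; exact mem_univ _)
    rw [OpensChart.trivializationAt_apply, OpensChart.extChartAt_coe] at h
    exact h.unique hcvald
  have hwlift : MDifferentiableAt 𝓘(ℝ, ℝ) 𝓘(ℝ, E).tangent
      (fun t ↦ (TotalSpace.mk' E (ĉ t) (show TangentSpace 𝓘(ℝ, E) (ĉ t) from w t) :
        TangentBundle 𝓘(ℝ, E) (chartTarget 𝓘(ℝ, E) x₁))) t₀ := by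
    have hm : (TotalSpace.mk' E (ĉ t₀) (show TangentSpace 𝓘(ℝ, E) (ĉ t₀) from w t₀) :
        TangentBundle 𝓘(ℝ, E) (chartTarget 𝓘(ℝ, E) x₁)) ∈
        (trivializationAt E (TangentSpace 𝓘(ℝ, E)) (ĉ t₀)).source :=
      (trivializationAt E (TangentSpace 𝓘(ℝ, E)) (ĉ t₀)).mem_source.2
        (by simp [OpensChart.chartAt_source])
    refine ((trivializationAt E (TangentSpace 𝓘(ℝ, E)) (ĉ t₀)).mdifferentiableAt_totalSpace_iff
      𝓘(ℝ, E) (fun t ↦ (TotalSpace.mk' E (ĉ t) (show TangentSpace 𝓘(ℝ, E) (ĉ t) from w t) :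
        TangentBundle 𝓘(ℝ, E) (chartTarget 𝓘(ℝ, E) x₁))) hm).2 ⟨hĉd, ?_⟩
    simp only [OpensChart.trivializationAt_apply]
    exact mdifferentiableAt_iff_differentiableAt.2 hwd
  -- (iii) naturality of the induced covariant derivative under `Φ`
  have hnat := g.mfderiv_covariantDerivAlong_comap contMDiff_pullbackBilin_holds
    (contMDiff_chartInv x₁) (injective_mfderiv_chartInv x₁) rfl hwlift
  -- (iv) the formula on the open subset of `E`
  set b := Module.finBasis ℝ E with hb
  set Ĉ : Fin (Module.finrank ℝ E) → chartTarget 𝓘(ℝ, E) x₁ → (E →L[ℝ] E) := fun i y ↦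
    OpensChart.christoffel (chartPullback 𝓘(ℝ, E) g x₁) G y (b i) with hĈ_def
  have hN : (univ : Set (chartTarget 𝓘(ℝ, E) x₁)) ⊆ (chartAt E (ĉ t₀)).source := fun y _ ↦ by
    simp [OpensChart.chartAt_source]
  have hĈ : ∀ y ∈ (univ : Set (chartTarget 𝓘(ℝ, E) x₁)), ∀ (i) (v : TangentSpace 𝓘(ℝ, E) y),
      Ĉ i y ((trivializationAt E (TangentSpace 𝓘(ℝ, E)) (ĉ t₀)).continuousLinearMapAt ℝ y v) =
        ((trivializationAt E (TangentSpace 𝓘(ℝ, E)) (ĉ t₀))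
          ⟨y, (chartPullback 𝓘(ℝ, E) g x₁).leviCivita
            ((trivializationAt E (TangentSpace 𝓘(ℝ, E)) (ĉ t₀)).localFrame b i) y v⟩).2 := by
    intro y _ i v
    rw [OpensChart.continuousLinearMapAt_trivializationAt_apply, OpensChart.trivializationAt_apply,
      OpensChart.localFrame_trivializationAt]
    exact (OpensChart.leviCivita_const_apply hG y (hGd y) (b i) v).symm
  have hformula := continuousLinearMapAt_covariantDerivAlong_symmL b Ĉ
    (chartPullback 𝓘(ℝ, E) g x₁).leviCivita hN hĈ (mem_univ (ĉ t₀)) hĉd hwd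
  rw [OpensChart.continuousLinearMapAt_trivializationAt_apply, OpensChart.trivializationAt_apply,
    hvel] at hformula
  have hfield : (fun t' ↦ (trivializationAt E (TangentSpace 𝓘(ℝ, E)) (ĉ t₀)).symmL ℝ (ĉ t')
      (w t')) = fun t' ↦ (show TangentSpace 𝓘(ℝ, E) (ĉ t') from w t') :=
    funext fun t' ↦ OpensChart.symmL_trivializationAt_apply _ _ _
  rw [hfield] at hformula
  have hconn : connMatrix b Ĉ (ĉ t₀) U₀ (w t₀) = MetricCoord.chrAt G (φ (γ t₀)) U₀ (w t₀) := by
    rw [connMatrix_apply]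
    simp only [hĈ_def]
    rw [← OpensChart.christoffel_sum, b.sum_repr, OpensChart.christoffel_eq_chrAt hG, hĉval t₀ hx]
  rw [hconn] at hformula
  -- assemble
  have hbase : Φ (ĉ t₀) = γ t₀ := hΦĉ t₀ hx
  have e1 : covariantDerivAlong g.leviCivita γ W t₀ = covariantDerivAlong g.leviCivita (Φ ∘ ĉ)
      (fun t ↦ mfderiv 𝓘(ℝ, E) 𝓘(ℝ, E) Φ (ĉ t) (w t)) t₀ := hcongr.symm
  have e2 : covariantDerivAlong g.leviCivita (Φ ∘ ĉ)
      (fun t ↦ mfderiv 𝓘(ℝ, E) 𝓘(ℝ, E) Φ (ĉ t) (w t)) t₀ =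
      mfderiv 𝓘(ℝ, E) 𝓘(ℝ, E) Φ (ĉ t₀)
        (covariantDerivAlong (chartPullback 𝓘(ℝ, E) g x₁).leviCivita ĉ
          (fun t ↦ (show TangentSpace 𝓘(ℝ, E) (ĉ t) from w t)) t₀) := hnat.symm
  have e3 : mfderiv 𝓘(ℝ, E) 𝓘(ℝ, E) φ (γ t₀) (mfderiv 𝓘(ℝ, E) 𝓘(ℝ, E) Φ (ĉ t₀)
      (covariantDerivAlong (chartPullback 𝓘(ℝ, E) g x₁).leviCivita ĉ
        (fun t ↦ (show TangentSpace 𝓘(ℝ, E) (ĉ t) from w t)) t₀)) =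
      covariantDerivAlong (chartPullback 𝓘(ℝ, E) g x₁).leviCivita ĉ
        (fun t ↦ (show TangentSpace 𝓘(ℝ, E) (ĉ t) from w t)) t₀ := by
    have h := mfderiv_extChartAt_chartInv_apply (I := 𝓘(ℝ, E)) x₁ (ĉ t₀)
      (covariantDerivAlong (chartPullback 𝓘(ℝ, E) g x₁).leviCivita ĉ
        (fun t ↦ (show TangentSpace 𝓘(ℝ, E) (ĉ t) from w t)) t₀)
    rw [← hΦdef, hbase] at h
    exact h
  rw [e1, e2, e3, hformula]

/-- **A parallel field satisfies `ŵ' = −Γ_c(U, ŵ)` in every chart.** If `W` is parallel along `γ`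
near `t₀` (`IsParallelAlongOn` on a neighbourhood) and `γ t₀` lies in the domain of the chart at
`x₁`, the components `ŵ = D(extChartAt x₁)(W)` have derivative `−Γ_{c t₀}(U t₀, ŵ t₀)` at `t₀`.
[cite: ONeill1983, Ch. 3, Prop. 3.18 and Prop. 3.59] -/
theorem hasDerivAt_chart_of_covariantDerivAlong_eq_zero (x₁ : M) {γ : ℝ → M}
    {W : Π t : ℝ, TangentSpace 𝓘(ℝ, E) (γ t)} {t₀ : ℝ}
    (hx : γ t₀ ∈ (extChartAt 𝓘(ℝ, E) x₁).source)
    (hW : MDifferentiableAt 𝓘(ℝ, ℝ) 𝓘(ℝ, E).tangent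
      (fun t ↦ (TotalSpace.mk' E (γ t) (W t) : TangentBundle 𝓘(ℝ, E) M)) t₀)
    (h0 : covariantDerivAlong g.leviCivita γ W t₀ = 0) :
    HasDerivAt (fun t ↦ mfderiv 𝓘(ℝ, E) 𝓘(ℝ, E) (extChartAt 𝓘(ℝ, E) x₁) (γ t) (W t))
      (-MetricCoord.chrAt (chartRep 𝓘(ℝ, E) (fun _ ↦ g) x₁ 0) (extChartAt 𝓘(ℝ, E) x₁ (γ t₀))
          (mfderiv 𝓘(ℝ, E) 𝓘(ℝ, E) (extChartAt 𝓘(ℝ, E) x₁) (γ t₀) (velocity 𝓘(ℝ, E) γ t₀))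
          (mfderiv 𝓘(ℝ, E) 𝓘(ℝ, E) (extChartAt 𝓘(ℝ, E) x₁) (γ t₀) (W t₀))) t₀ := by
  obtain ⟨hd, hformula⟩ := covariantDerivAlong_chart g x₁ hx hW
  rw [h0, map_zero] at hformula
  have h := hd.hasDerivAt
  rwa [eq_neg_of_add_eq_zero_left hformula.symm] at h

end Literature.Geometry.Riemannian

end
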